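import Literature.NumberTheory.GaloisRepresentations.AbsGaloisConjByTransportProofs
import Literature.NumberTheory.Automorphic.GaloisActionPlaces
import HarnessLib

/-!
# Conjugation of `Γ_K` by a lift `σ̃` of an automorphism `γ` of `K`: transport of ARITHMETIC FROBENIUS
# elements to the conjugate prime `σ̃⁻¹𝔓` over `γ⁻¹ v`

Topic `Literature/NumberTheory/GaloisRepresentations`, namespace `Literature.NumberTheory.GaloisRepresentations`
(sequel to ★ `AbsGaloisConjBy`, ★ `AbsGaloisConjByPrime`, ★ `AbsGaloisConjByTransportProofs`).  THEOREMS ONLY: no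
definition, no named fact, no instance, no `sorry`.

Setting: `K` a number field, `γ : K ≃ₐ[F₀] K` an automorphism over a subfield `F₀` (e.g. complex conjugation of a
CM field over its maximal real subfield), `σ̃ : K̄ ≃+* K̄` a ring automorphism of `K̄ = AlgebraicClosure K` lifting `γ`
(`hσa`), `f = absGalConjBy σ̃ γ hσa : Γ_K →* Γ_K`, `τ ↦ σ̃⁻¹ τ σ̃` (★ `AbsGaloisConjBy`), `𝔓` an ideal of the algebraic
integers `\bar ℤ_K = absIntegers (𝓞 K) K` and `𝔓' = σ̃⁻¹𝔓` the ideal with `x ∈ 𝔓' ↔ σ̃ x ∈ 𝔓` (hypothesis `h𝔓'`;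
existence ★ `exists_ideal_forall_mem_iff_apply_mem`).  Neukirch, *Algebraic Number Theory*, Ch. I §9, p. 54 and
(9.4)–(9.6): for an automorphism `σ` of the big field, the decomposition group, inertia group AND THE FROBENIUS of the
conjugate prime are the conjugates — here for the SEMILINEAR `σ̃` (not in `Γ_K`), read through `f`, with the prime
MOVING from `𝔓 ∣ v` to `σ̃⁻¹𝔓 ∣ γ⁻¹ v` (the twin of ★ `isArithFrobAt_absGalConjBy`, which treats a `σ̃` FIXING `𝔓`):

* `under_eq_inv_smul_under` — `σ̃⁻¹𝔓 ∩ 𝓞 K = γ⁻¹ (𝔓 ∩ 𝓞 K)`;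
* `natCard_quotient_under_eq` — the residue fields of `𝔓 ∩ 𝓞 K` and `σ̃⁻¹𝔓 ∩ 𝓞 K` have the same cardinality;
* **`isArithFrobAt_absGalConjBy_of_forall_mem_iff`** — `IsArithFrobAt (𝓞 K) τ 𝔓 → IsArithFrobAt (𝓞 K) (σ̃⁻¹τσ̃) (σ̃⁻¹𝔓)`
  (`(σ̃⁻¹τσ̃) x − x ^ N𝔭 = σ̃⁻¹ (τ (σ̃ x) − (σ̃ x) ^ N𝔭) ∈ σ̃⁻¹𝔓`);
* `isPrime_of_forall_mem_iff`, `mem_primesAbove_inv_smul_of_forall_mem_iff` — `𝔓 ∣ v ⇒ σ̃⁻¹𝔓 ∣ γ⁻¹ v`;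
* **`exists_mem_primesAbove_isArithFrobAt_absGalConjBy`** — the packaged form: an arithmetic Frobenius `τ` at some
  `𝔓 ∣ v` conjugates to an arithmetic Frobenius `σ̃⁻¹τσ̃` at some prime above `γ⁻¹ v`.

Written for the cell `hodgecm-mathlib` (D-0151) as the Galois-side half of the «K2 transport lemma» (the c-twist
`X_K = M_K ⊗_{F,c} F` of a canonical model carries, at a place `v`, the arithmetic Frobenius of `M` at `c v`).
Classical algebraic number theory; nothing specific to Shimura varieties is used or asserted.

References: [NeukirchANT1999] J. Neukirch, *Algebraic Number Theory* (1999), Ch. I §9, p. 54 («σ𝒪 = 𝒪», the primes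
above `σ𝔭`) and Prop. (9.4)–(9.6); [CasselsFrohlichANT1967] Ch. VII (Tate) §1.1 (action of automorphisms on primes and
Frobenius elements).
-/

noncomputable section

open scoped Pointwise NumberField
open NumberField Field
open Literature.NumberTheory.NumberFields
open IsDedekindDomain

namespace Literature.NumberTheory.GaloisRepresentations

universe u

section Transport

variable {F₀ K : Type} [Field F₀] [Field K] [NumberField K] [Algebra F₀ K]
  (γ : K ≃ₐ[F₀] K) (σt : AlgebraicClosure K ≃+* AlgebraicClosure K)
  (hσa : ∀ a : K, σt (algebraMap K (AlgebraicClosure K) a) = algebraMap K (AlgebraicClosure K) (γ a))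

variable {𝔓 𝔓' : Ideal (absIntegers (𝓞 K) K)}
  (h𝔓' : ∀ x : absIntegers (𝓞 K) K,
    x ∈ 𝔓' ↔ (⟨σt x, ringEquiv_apply_mem_absIntegers σt x.2⟩ : absIntegers (𝓞 K) K) ∈ 𝔓)

omit [NumberField K] in
/-- The algebraic integer `ι(a)` of an integer `a ∈ 𝓞 K` (the structure map `𝓞 K → \bar ℤ_K`), as an element of
`\bar ℤ_K` with underlying element `ι(a) ∈ K̄`. [folklore] -/
private theorem coe_algebraMap_absIntegers (a : 𝓞 K) :
    ((algebraMap (𝓞 K) (absIntegers (𝓞 K) K) a : absIntegers (𝓞 K) K) : AlgebraicClosure K) =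
      algebraMap K (AlgebraicClosure K) (a : K) := by
  rw [Subalgebra.coe_algebraMap]
  exact IsScalarTower.algebraMap_apply (𝓞 K) K (AlgebraicClosure K) a

omit [NumberField K] in
include hσa in
/-- `σ̃ (ι a) = ι (γ a)` for `a ∈ 𝓞 K`, as elements of `\bar ℤ_K`. [cite: NeukirchANT1999, Ch. I §9 (p. 54: σ𝒪 = 𝒪)] -/
theorem apply_algebraMap_absIntegers (a : 𝓞 K) :
    (⟨σt (algebraMap (𝓞 K) (absIntegers (𝓞 K) K) a),
        ringEquiv_apply_mem_absIntegers σt (algebraMap (𝓞 K) (absIntegers (𝓞 K) K) a).2⟩ :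
        absIntegers (𝓞 K) K) =
      algebraMap (𝓞 K) (absIntegers (𝓞 K) K) (γ • a) := by
  apply Subtype.ext
  change σt ((algebraMap (𝓞 K) (absIntegers (𝓞 K) K) a : absIntegers (𝓞 K) K) : AlgebraicClosure K) =
    ((algebraMap (𝓞 K) (absIntegers (𝓞 K) K) (γ • a) : absIntegers (𝓞 K) K) : AlgebraicClosure K)
  rw [coe_algebraMap_absIntegers, coe_algebraMap_absIntegers, hσa]
  rfl

omit [NumberField K] in
include hσa h𝔓' in
/-- **`σ̃⁻¹𝔓 ∩ 𝓞 K = γ⁻¹ (𝔓 ∩ 𝓞 K)`**: the prime of `K` below the conjugate prime is the `γ⁻¹`-conjugate of the prime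
below `𝔓`. [cite: NeukirchANT1999, Ch. I §9 (p. 54)] -/
theorem under_eq_inv_smul_under : 𝔓'.under (𝓞 K) = γ⁻¹ • 𝔓.under (𝓞 K) := by
  ext a
  rw [Ideal.mem_inv_pointwise_smul_iff, Ideal.under_def, Ideal.under_def, Ideal.mem_comap, Ideal.mem_comap, h𝔓',
    apply_algebraMap_absIntegers γ σt hσa]

omit [NumberField K] in
include hσa h𝔓' in
/-- The residue rings of `𝔓 ∩ 𝓞 K` and `σ̃⁻¹𝔓 ∩ 𝓞 K` have the same cardinality (`γ⁻¹` induces a ring isomorphism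
`𝓞 K ⧸ (𝔓 ∩ 𝓞 K) ≃ 𝓞 K ⧸ γ⁻¹(𝔓 ∩ 𝓞 K)`). [cite: NeukirchANT1999, Ch. I §9 (p. 54)] -/
theorem natCard_quotient_under_eq :
    Nat.card (𝓞 K ⧸ 𝔓'.under (𝓞 K)) = Nat.card (𝓞 K ⧸ 𝔓.under (𝓞 K)) := by
  rw [under_eq_inv_smul_under γ σt hσa h𝔓']
  exact (Nat.card_congr (Ideal.quotientEquiv (𝔓.under (𝓞 K)) (γ⁻¹ • 𝔓.under (𝓞 K))
    (MulSemiringAction.toRingEquiv _ (𝓞 K) γ⁻¹) (Ideal.pointwise_smul_def _)).toEquiv).symm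

include h𝔓' in
/-- **Transport of arithmetic Frobenius elements to the conjugate prime**: if `τ ∈ Γ_K` is an arithmetic Frobenius at
`𝔓` (`τ x ≡ x ^ N𝔭 (mod 𝔓)` on `\bar ℤ_K`, `N𝔭 = #(𝓞 K ⧸ 𝔓 ∩ 𝓞 K)`), then `σ̃⁻¹τσ̃` is an arithmetic Frobenius at
`σ̃⁻¹𝔓`: `(σ̃⁻¹τσ̃) x − x ^ N𝔭 = σ̃⁻¹ (τ (σ̃ x) − (σ̃ x) ^ N𝔭) ∈ σ̃⁻¹𝔓`, and `N(σ̃⁻¹𝔓 ∩ 𝓞 K) = N𝔭`.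
[cite: NeukirchANT1999, Ch. I §9 Prop. (9.4)–(9.5) and the remark after (9.5)] [cite: CasselsFrohlichANT1967, Ch. VII §1.1] -/
theorem isArithFrobAt_absGalConjBy_of_forall_mem_iff {τ : absoluteGaloisGroup K}
    (hτ : IsArithFrobAt (𝓞 K) τ 𝔓) : IsArithFrobAt (𝓞 K) (absGalConjBy σt (γ : K ≃+* K) hσa τ) 𝔓' := by
  intro x
  rw [MulSemiringAction.toAlgHom_apply, natCard_quotient_under_eq γ σt hσa h𝔓']
  set y : absIntegers (𝓞 K) K := ⟨σt x, ringEquiv_apply_mem_absIntegers σt x.2⟩ with hy_def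
  have hy : τ • y - y ^ Nat.card (𝓞 K ⧸ 𝔓.under (𝓞 K)) ∈ 𝔓 := by
    have h := hτ y
    rwa [MulSemiringAction.toAlgHom_apply] at h
  have key : absGalConjBy σt (γ : K ≃+* K) hσa τ • x - x ^ Nat.card (𝓞 K ⧸ 𝔓.under (𝓞 K)) =
      ⟨σt.symm ((τ • y - y ^ Nat.card (𝓞 K ⧸ 𝔓.under (𝓞 K)) : absIntegers (𝓞 K) K) :
          AlgebraicClosure K),
        ringEquiv_apply_mem_absIntegers σt.symm (τ • y - y ^ Nat.card (𝓞 K ⧸ 𝔓.under (𝓞 K))).2⟩ := by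
    apply Subtype.ext
    simp only [hy_def, Subalgebra.coe_sub, Subalgebra.coe_pow, integralClosure.coe_smul, map_sub, map_pow,
      absGalConjBy_smul, RingEquiv.symm_apply_apply]
  rw [key]
  exact (mem_iff_symm_apply_mem σt h𝔓' _).mp hy

omit [NumberField K] in
include h𝔓' in
/-- The conjugate `σ̃⁻¹𝔓` of a prime ideal of `\bar ℤ_K` is prime. [cite: NeukirchANT1999, Ch. I §9 (p. 54)] -/
theorem isPrime_of_forall_mem_iff (h𝔓 : 𝔓.IsPrime) : 𝔓'.IsPrime := by
  refine ⟨fun htop => h𝔓.ne_top ?_, fun {x y} hxy => ?_⟩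
  · rw [Ideal.eq_top_iff_one] at htop ⊢
    have h1 := (h𝔓' 1).mp htop
    have h1' : (⟨σt (1 : absIntegers (𝓞 K) K), ringEquiv_apply_mem_absIntegers σt (1 : absIntegers (𝓞 K) K).2⟩ :
        absIntegers (𝓞 K) K) = 1 := Subtype.ext (by simp)
    rwa [h1'] at h1
  · rw [h𝔓'] at hxy
    have hmul : (⟨σt ((x * y : absIntegers (𝓞 K) K) : AlgebraicClosure K),
        ringEquiv_apply_mem_absIntegers σt (x * y).2⟩ : absIntegers (𝓞 K) K) =
        (⟨σt x, ringEquiv_apply_mem_absIntegers σt x.2⟩ : absIntegers (𝓞 K) K) *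
          ⟨σt y, ringEquiv_apply_mem_absIntegers σt y.2⟩ := Subtype.ext (by simp)
    rw [hmul] at hxy
    rcases h𝔓.mem_or_mem hxy with hx | hy
    · exact Or.inl ((h𝔓' x).mpr hx)
    · exact Or.inr ((h𝔓' y).mpr hy)

omit [NumberField K] in
include hσa h𝔓' in
/-- **`𝔓 ∣ v ⇒ σ̃⁻¹𝔓 ∣ γ⁻¹ v`**: if `𝔓` lies above the finite place `v` of `K` then `σ̃⁻¹𝔓` lies above `γ⁻¹ v`.
[cite: NeukirchANT1999, Ch. I §9 (p. 54: the primes above σ𝔭)] -/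
theorem mem_primesAbove_inv_smul_of_forall_mem_iff {v : HeightOneSpectrum (𝓞 K)} (h𝔓 : 𝔓 ∈ v.primesAbove) :
    𝔓' ∈ (γ⁻¹ • v).primesAbove := by
  rw [HeightOneSpectrum.mem_primesAbove_iff] at h𝔓 ⊢
  refine ⟨isPrime_of_forall_mem_iff σt h𝔓' h𝔓.1, ⟨?_⟩⟩
  rw [Literature.NumberTheory.Automorphic.HeightOneSpectrum.smul_asIdeal, under_eq_inv_smul_under γ σt hσa h𝔓',
    ← h𝔓.2.over]

include hσa in
/-- **Packaged form** (the shape consumed by the c-twist transport of the cell `hodgecm-mathlib`): an arithmetic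
Frobenius `τ` at a prime `𝔓 ∣ v` conjugates, under `τ ↦ σ̃⁻¹τσ̃`, to an arithmetic Frobenius at SOME prime above
`γ⁻¹ v` (namely `σ̃⁻¹𝔓`). [cite: NeukirchANT1999, Ch. I §9 Prop. (9.4)–(9.5)] [cite: CasselsFrohlichANT1967, Ch. VII §1.1] -/
theorem exists_mem_primesAbove_isArithFrobAt_absGalConjBy (v : HeightOneSpectrum (𝓞 K))
    {𝔓 : Ideal (absIntegers (𝓞 K) K)} (h𝔓 : 𝔓 ∈ v.primesAbove) {τ : absoluteGaloisGroup K}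
    (hτ : IsArithFrobAt (𝓞 K) τ 𝔓) :
    ∃ 𝔓' ∈ (γ⁻¹ • v).primesAbove, IsArithFrobAt (𝓞 K) (absGalConjBy σt (γ : K ≃+* K) hσa τ) 𝔓' := by
  obtain ⟨𝔓', -, h𝔓'⟩ := exists_ideal_forall_mem_iff_apply_mem σt 𝔓
  exact ⟨𝔓', mem_primesAbove_inv_smul_of_forall_mem_iff γ σt hσa h𝔓' h𝔓,
    isArithFrobAt_absGalConjBy_of_forall_mem_iff γ σt hσa h𝔓' hτ⟩

end Transport

end Literature.NumberTheory.GaloisRepresentations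

end
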